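import Summits.CriticalPhenomena.PercolationContinuityZ3.Theorems.PercNearOneGluingNoHeavyLowerTailMixMetaA2
import Summits.CriticalPhenomena.PercolationContinuityZ3.Theorems.PercNearOneGluingNoHeavyLowerTailMixCSHWorld
import HarnessLib

/-!
# Mixed conditioned slack hierarchy — META-A2 with the HUB observer functional (finite-sum core of (Htw-mix))

Support file (`--supports stmt-CriticalPhenomena-4575`), prover `prim-ineq-gen-7` (gen 8).  No definitions, no named facts, no sorries.
Memo `prim-ineq-gen-7/Q9-WRITEUP.md` Lemma 5.2; blueprint `PROOF-Q9-MIXED-CSH.md` §10 brick B4 (finite-sum part).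

`CovTau.metaA2_mix_of_star`: the hub analogue of `CovTau.metaA2_of_star` — for every `N, N' ⊆ U`,

  `E^mix_A(N) · Y_F(N') ≤ M_A(N ∪ N') · Y_{q^mix·F}(N ∩ N')`,

where `E^mix_A(N) = μ_{G[U]}(Σ ∩ C_v ≠ ∅, v ↮ A ∪ N, Σ ⊆ U, Σ ↮ A ∪ N)` (`CovTau.EavMix`, p212440), `M_A(N) = μ(v ↮ A ∪ N)`,
`Y_F(N) = E[F(U ∖ C_N); x ↮ N]` for a pure world functional `F ≥ 0` vanishing on worlds without `v`, and `q^mix(U') = E^mix_A(∅)/M_A(∅)` in `G[U']`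
— modulo the one-source bound `(★^F)` and `(anti)` for `Y_F` (exactly as in `metaA2_of_star`, discharged for the covariance functional by prim-hp-4's `StarH`)
and the TWO-SET van den Berg–Häggström–Kahn input for the hub in finitary form (`hGP`: under `v ↮ A`, the bi-monotone hub weight
`1{Σ ∩ C_v ≠ ∅}·1{Σ ↮ A}` and the decreasing `1{v ↮ N}` are negatively correlated; vdBHK Thm 2.1 at `q = 1`, supplied by the caller).
Proof: `CovTau.metaA2_abstract` (p212087) with `(f₁, f₂, f₃, f₄) = (E^mix_A, Y_F, M_A, Y_{q^mix F})`, admissibility `v ∈ U' ∧ v ∉ Z ∧ x ∉ Z`, the star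
decompositions `EavMix_step` / `Yw_step` / `Mav_step`, and the disjoint-sources bound from `(★^F)`, `hGP` and BHK Thm 1.3 (`BHK2006.core` with `F = G = 1`).
[cite: VandenbergHaggstromKahn2005, Thm. 1.1 (pp. 3–5), Thm. 1.3 (p. 6), Thm. 2.1 (p. 8)] [cite: KozmaNitzan2024, Question 9 (§5.5 p. 36)]
-/

noncomputable section

namespace Summit.CriticalPhenomena.PercolationContinuityZ3.Theorems.CovTau

open Literature.Probability.Percolation
open Literature.Probability.Percolation.BHK2006
open Literature.Probability.Percolation.DecisionTree (ind ind_of_mem ind_of_not_mem ind_nonneg)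
open scoped Classical

variable {V : Type*} [Fintype V]

/-- **Hub core inequality**: `E^mix_A(N) · M_A(N') ≤ E^mix_A(∅) · M_A(N ∪ N')` for `v ∈ U`, from the two-set input `hGP` and BHK Thm 1.3.
[cite: VandenbergHaggstromKahn2005, Thm. 1.3 (p. 6), Thm. 2.1 (p. 8)] -/
theorem EavMix_mul_Mav_le (w : Sym2 V → ℝ) (hw0 : ∀ e, 0 ≤ w e) (hw1 : ∀ e, w e ≤ 1)
    (hm : ∑ ω, weight w ω = 1) (A : Set V) (Sig : Finset V) {v : V} {U : Finset V} (hvU : v ∈ U)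
    (hGP : ∀ N : Set V, N ⊆ ↑U →
      (∑ ω, weight w ω * (hubInd Sig v (rC U v ω) * ind (rD U v (A ∪ N)) ω * ind (avoidAll U Sig A) ω)) *
        Mav w U A v ∅ ≤ EavMix w U A Sig v ∅ * Mav w U A v N)
    {N : Set V} (hNU : N ⊆ ↑U) (N' : Set V) :
    EavMix w U A Sig v N * Mav w U A v N' ≤ EavMix w U A Sig v ∅ * Mav w U A v (N ∪ N') := by
  have hM0 := Mav_nonneg hw0 hw1 U A v (∅ : Set V) (w := w)
  have hE0 := EavMix_nonneg hw0 hw1 U A Sig v (∅ : Set V) (w := w)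
  have hEN := EavMix_nonneg hw0 hw1 U A Sig v N (w := w)
  have hMN' := Mav_nonneg hw0 hw1 U A v N' (w := w)
  have hMu := Mav_nonneg hw0 hw1 U A v (N ∪ N') (w := w)
  -- drop the factor `1{Σ ↮ N}`
  set E1 : ℝ := ∑ ω, weight w ω *
    (hubInd Sig v (rC U v ω) * ind (rD U v (A ∪ N)) ω * ind (avoidAll U Sig A) ω) with hE1
  have hle1 : EavMix w U A Sig v N ≤ E1 := by
    unfold EavMix
    refine Finset.sum_le_sum fun ω _ => mul_le_mul_of_nonneg_left ?_ (weight_nonneg hw0 hw1 ω)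
    exact mul_le_mul_of_nonneg_left (ind_mono (avoidAll_antitone U Sig Set.subset_union_left) ω)
      (mul_nonneg (hubInd_nonneg _ _ _) (ind_nonneg _ _))
  -- BHK Thm 1.3 for the avoidance probabilities: `M(N)·M(N') ≤ M(∅)·M(N ∪ N')`
  have hcore := core w hw0 hw1 hm U v hvU ((A ∪ N) ∩ ↑U) ((A ∪ N') ∩ ↑U)
    Set.inter_subset_right Set.inter_subset_right (fun _ => (1 : ℝ)) (fun _ => (1 : ℝ))
    monotone_const monotone_const (fun _ => zero_le_one) (fun _ => zero_le_one)
  have hi : ∀ a ∈ U, a ∈ (A ∪ N) ∩ ↑U ∩ ((A ∪ N') ∩ ↑U) ↔ a ∈ A ∪ (N ∩ N') := fun a haU => by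
    simp only [Set.mem_inter_iff, Set.mem_union, Finset.mem_coe]
    tauto
  have hu : ∀ a ∈ U, a ∈ (A ∪ N) ∩ ↑U ∪ (A ∪ N') ∩ ↑U ↔ a ∈ A ∪ (N ∪ N') := fun a haU => by
    simp only [Set.mem_inter_iff, Set.mem_union, Finset.mem_coe]
    tauto
  simp only [one_mul] at hcore
  rw [rD_eq_of_agree U hvU hi, rD_eq_of_agree U hvU hu, ← Mav_eq_inter w U A hvU, ← Mav_eq_inter w U A hvU] at hcore
  change Mav w U A v N * Mav w U A v N' ≤ Mav w U A v (N ∩ N') * Mav w U A v (N ∪ N') at hcore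
  have hcore' : Mav w U A v N * Mav w U A v N' ≤ Mav w U A v ∅ * Mav w U A v (N ∪ N') :=
    hcore.trans (mul_le_mul_of_nonneg_right (Mav_antitone hw0 hw1 U A v (Set.empty_subset _)) hMu)
  have hgp := hGP N hNU
  rcases hM0.eq_or_lt with hM0e | hM0p
  · -- `μ(v ↮ A) = 0`: everything vanishes
    have hEN0 : EavMix w U A Sig v N = 0 := le_antisymm
      ((EavMix_le_Mav hw0 hw1 U A Sig v N).trans
        ((Mav_antitone hw0 hw1 U A v (Set.empty_subset N)).trans hM0e.symm.le)) hEN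
    rw [hEN0, zero_mul]; exact mul_nonneg hE0 hMu
  · -- divide by `M(∅) > 0`
    have key : EavMix w U A Sig v N * Mav w U A v N' * Mav w U A v ∅ ≤
        EavMix w U A Sig v ∅ * Mav w U A v (N ∪ N') * Mav w U A v ∅ :=
      calc EavMix w U A Sig v N * Mav w U A v N' * Mav w U A v ∅
          ≤ E1 * Mav w U A v N' * Mav w U A v ∅ :=
            mul_le_mul_of_nonneg_right (mul_le_mul_of_nonneg_right hle1 hMN') hM0
        _ = (E1 * Mav w U A v ∅) * Mav w U A v N' := by ring
        _ ≤ (EavMix w U A Sig v ∅ * Mav w U A v N) * Mav w U A v N' := mul_le_mul_of_nonneg_right hgp hMN'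
        _ = EavMix w U A Sig v ∅ * (Mav w U A v N * Mav w U A v N') := by ring
        _ ≤ EavMix w U A Sig v ∅ * (Mav w U A v ∅ * Mav w U A v (N ∪ N')) := mul_le_mul_of_nonneg_left hcore' hE0
        _ = _ := by ring
    exact le_of_mul_le_mul_right key hM0p

/-- **META-A2 with the hub observer functional, modulo the one-source bounds and the two-set input** — see the module docstring.
[cite: VandenbergHaggstromKahn2005, Thm. 1.1 (pp. 3–5), Thm. 1.3 (p. 6), Thm. 2.1 (p. 8)] -/
theorem metaA2_mix_of_star (w : Sym2 V → ℝ) (hw0 : ∀ e, 0 ≤ w e) (hw1 : ∀ e, w e ≤ 1)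
    (hm : ∑ ω, weight w ω = 1) (x v : V) (A : Set V) (Sig : Finset V) {F : Finset V → ℝ}
    (hF0 : ∀ U' : Finset V, 0 ≤ F U') (hFv : ∀ U' : Finset V, v ∉ U' → F U' = 0) (U : Finset V)
    (hstar : ∀ U' ⊆ U, ∀ N : Set V, N ⊆ ↑U' →
      Yw w U' x F N * Mav w U' A v ∅ ≤ Mav w U' A v N * F U')
    (hanti : ∀ U' ⊆ U, ∀ N N' : Set V, N ⊆ N' → N' ⊆ ↑U' → Yw w U' x F N' ≤ Yw w U' x F N)
    (hGP : ∀ U' ⊆ U, v ∈ U' → ∀ N : Set V, N ⊆ ↑U' →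
      (∑ ω, weight w ω * (hubInd Sig v (rC U' v ω) * ind (rD U' v (A ∪ N)) ω * ind (avoidAll U' Sig A) ω)) *
        Mav w U' A v ∅ ≤ EavMix w U' A Sig v ∅ * Mav w U' A v N) :
    ∀ N N' : Set V, N ⊆ ↑U → N' ⊆ ↑U →
      EavMix w U A Sig v N * Yw w U x F N' ≤
        Mav w U A v (N ∪ N') * Yw w U x (fun U' => EavMix w U' A Sig v ∅ / Mav w U' A v ∅ * F U') (N ∩ N') := by
  -- the fourth functional is nonnegative
  have hq0 : ∀ U' : Finset V, 0 ≤ EavMix w U' A Sig v ∅ / Mav w U' A v ∅ * F U' := fun U' =>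
    mul_nonneg (div_nonneg (EavMix_nonneg hw0 hw1 U' A Sig v ∅) (Mav_nonneg hw0 hw1 U' A v ∅)) (hF0 U')
  refine metaA2_abstract w hw0 hw1 hm (fun U' Z => v ∈ U' ∧ v ∉ Z ∧ x ∉ Z)
    (fun U' N => EavMix w U' A Sig v N) (fun U' N => Yw w U' x F N) (fun U' N => Mav w U' A v N)
    (fun U' N => Yw w U' x (fun U'' => EavMix w U'' A Sig v ∅ / Mav w U'' A v ∅ * F U'') N)
    (fun U' N => EavMix_nonneg hw0 hw1 U' A Sig v N) (fun U' N => Yw_nonneg hw0 hw1 U' x hF0 N)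
    (fun U' N => Mav_nonneg hw0 hw1 U' A v N) (fun U' N => Yw_nonneg hw0 hw1 U' x hq0 N) U
    ?_ ?_ ?_ ?_ ?_ ?_ ?_ ?_
  · -- admissibility from non-vanishing
    intro U' _ N N' _ _ hne Z _ hZ
    have h1 : EavMix w U' A Sig v N ≠ 0 := fun h => hne (by rw [h, zero_mul])
    have h2 : Yw w U' x F N' ≠ 0 := fun h => hne (by rw [h, mul_zero])
    have hvU' : v ∈ U' := by
      by_contra hv; exact h2 (Yw_eq_zero_of_not_mem w x hFv hv N')
    have hvN : v ∉ A ∪ N := fun hv => h1 (EavMix_eq_zero_of_mem w U' A Sig v hv)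
    have hxN' : x ∉ N' := fun hx => h2 (Yw_eq_zero_of_mem w U' x F hx)
    exact ⟨hvU', fun hvZ => hvN (Or.inr (hZ (Finset.mem_coe.2 hvZ)).1),
      fun hxZ => hxN' (hZ (Finset.mem_coe.2 hxZ)).2⟩
  · intro U' _ Z hZU' hAdm _ N hZN _
    exact EavMix_step hZU' hAdm.1 hAdm.2.1 hZN w hm Sig
  · intro U' _ Z hZU' hAdm _ N hZN _
    exact Yw_step hZU' hAdm.2.2 hZN w hm F
  · intro U' _ Z hZU' hAdm _ N hZN _
    exact Mav_step hZU' hAdm.1 hAdm.2.1 hZN w hm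
  · intro U' _ Z hZU' hAdm _ N hZN _
    exact Yw_step hZU' hAdm.2.2 hZN w hm _
  · intro U' _ N N' hNN' _
    exact EavMix_antitone hw0 hw1 U' A Sig v hNN'
  · exact hanti
  · -- disjoint sources: `(★^F)`, the hub core inequality, division by `M(∅)`
    intro U' hU' N N' hNU' hN'U' hNN'
    rw [Yw_empty w hm]
    have hRHS : 0 ≤ Mav w U' A v (N ∪ N') * (EavMix w U' A Sig v ∅ / Mav w U' A v ∅ * F U') :=
      mul_nonneg (Mav_nonneg hw0 hw1 U' A v _) (hq0 U')
    by_cases hvU' : v ∈ U'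
    swap
    · rw [Yw_eq_zero_of_not_mem w x hFv hvU' N', mul_zero]; exact hRHS
    have hM0 := Mav_nonneg hw0 hw1 U' A v (∅ : Set V) (w := w)
    have hEN := EavMix_nonneg hw0 hw1 U' A Sig v N (w := w)
    have hY := Yw_nonneg hw0 hw1 U' x hF0 N' (w := w)
    have hMu := Mav_nonneg hw0 hw1 U' A v (N ∪ N') (w := w)
    have hE0 := EavMix_nonneg hw0 hw1 U' A Sig v (∅ : Set V) (w := w)
    have hst := hstar U' hU' N' hN'U'
    have hcore := EavMix_mul_Mav_le w hw0 hw1 hm A Sig hvU' (hGP U' hU' hvU') hNU' N'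
    have key : EavMix w U' A Sig v N * Yw w U' x F N' * Mav w U' A v ∅ ≤
        Mav w U' A v (N ∪ N') * (EavMix w U' A Sig v ∅ * F U') :=
      calc EavMix w U' A Sig v N * Yw w U' x F N' * Mav w U' A v ∅
          = EavMix w U' A Sig v N * (Yw w U' x F N' * Mav w U' A v ∅) := by ring
        _ ≤ EavMix w U' A Sig v N * (Mav w U' A v N' * F U') := mul_le_mul_of_nonneg_left hst hEN
        _ = (EavMix w U' A Sig v N * Mav w U' A v N') * F U' := by ring
        _ ≤ (EavMix w U' A Sig v ∅ * Mav w U' A v (N ∪ N')) * F U' := mul_le_mul_of_nonneg_right hcore (hF0 U')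
        _ = _ := by ring
    rcases hM0.eq_or_lt with hM0e | hM0p
    · have hEN0 : EavMix w U' A Sig v N = 0 := le_antisymm
        ((EavMix_le_Mav hw0 hw1 U' A Sig v N).trans
          ((Mav_antitone hw0 hw1 U' A v (Set.empty_subset N)).trans hM0e.symm.le)) hEN
      rw [hEN0, zero_mul]; exact hRHS
    · calc EavMix w U' A Sig v N * Yw w U' x F N'
          = EavMix w U' A Sig v N * Yw w U' x F N' * Mav w U' A v ∅ / Mav w U' A v ∅ := by
            field_simp
        _ ≤ Mav w U' A v (N ∪ N') * (EavMix w U' A Sig v ∅ * F U') / Mav w U' A v ∅ :=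
            div_le_div_of_nonneg_right key hM0p.le
        _ = Mav w U' A v (N ∪ N') * (EavMix w U' A Sig v ∅ / Mav w U' A v ∅ * F U') := by
            field_simp

end Summit.CriticalPhenomena.PercolationContinuityZ3.Theorems.CovTau
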